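import Summits.QuantumFields.YangMills.Theorems.UnitScaleTiltProp7FrameLevelOnto
import Summits.QuantumFields.YangMills.Theorems.UnitScaleTiltProp7FrameResponseChartGlue
import Summits.QuantumFields.YangMills.Theorems.UnitScaleTiltProp7TwistedSliceGaugeOnto
import HarnessLib

/-!
# Route `UnitScaleTilt`, crux K1 child «MinimiserStabilityRegPr» (stmt-QuantumFields-19200), skeleton v10, stub `stub_existenceMinimalOrbit` (EX), route (α) — **(P1) OF THE `hSplitD` ROW AT
# THE CHART POINT: `ker QSym(U′) ⊆ M·𝒯_{A₁} + 𝒢_{U′}` FOR `δ`-CLOSE COMPARISON TOWERS** — T4's displayed solvability hypothesis `hK` (✓`Prop7TwistedSliceGaugeOnto`) DISCHARGED by the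
# top-down tower construction (✓`Prop7FrameLevelOnto`) read through the GLUE (✓`Prop7FrameResponseChartGlue`); brick T5, the last of this seat's chain T1 → T2 → T3 → T4 → FR₀ → FR₁ → GLUE → T5
# of the chart-side TRANSPORT of `hXtw‴`(iii) (v3.3ˢ cut, ★★OWNER RULING g27-№5; junction ⧗`Prop7FibreELOfCritSplitD.fibreEL_of_crit_splitD`).

Cell `ym3-torus`, width seat `ym-ust-20520-w5` (gen 6).  THEOREMS ONLY (0 `def`, 0 `sorry`).  `--supports stmt-QuantumFields-19200 --as helper`, count-neutral.  YM₃ on T³ is a ladder rung (R3), not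
the Clay problem; nothing here claims the stub, the crux, d = 4 or the mass gap.

WHAT IS PROVED (sorry-free, no definition): `eta_le_one`; ★★★`exists_gaugeParam_frameCorrected_eq` (T4's `hK` for every coarse target `m`, under the displayed tower-closeness hypotheses);
★★★`exists_slice_tangent_add_gaugeDir_of_QSym_eq_zero_of_tower` ((P1): every `ξ ∈ ker QSym(U′)` is `Mβ + G_{U′}N` with `β` twisted-slice-tangent at `A₁`).
HONEST SCOPE: the tower closeness of the pair `(U₀♭, U′♭)` — relative transporters `‖τ_j(y) − 1‖ ≤ δ`, LOOP holonomies `‖H_{j,y,i}^{±1} − 1‖ ≤ δ` (gauge-invariant), `‖ν_j(x)^{±1}‖ ≤ 2`,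
`‖w_j(y)⁻¹‖ ≤ 2` at every level, `δ ≤ 1/200` — is DISPLAYED, not derived from `RegPr` here (it is the printed-regular towers' closeness, [Balaban1985Averaging] (58), (82); the nearest
in-tree letters are ✓`norm_dbarCovIterU_rel_sub_one_le_of_regPr`, ✓`norm_tstairU_sub_one_le_of_rel`, the frames' unitarity, and plaquette regularity of `Ū′⁽ʲ⁾` for the loops); everything is over `M₂(ℂ)` (the 𝔰𝔲(2)/reality bookkeeping and
(P2) = Landau transversality at the chart point are NOT treated); nothing of print is asserted.

References: T. Bałaban, CMP 98 (1985) 17–51 [Balaban1985Averaging] ((11) p.19, (58) p.27, (82) p.30, (97) p.32); CMP 99 (1985) 389–434 [Balaban1985BackgroundPropagators] ((3.19) p.393,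
(3.21) p.394, (3.114)–(3.115) p.418); CMP 102 (1985) 277–309 [Balaban1985Variational] ((44)–(49) p.285, (82)–(83) p.290).
-/

set_option autoImplicit false

noncomputable section

open scoped BigOperators Topology
open Filter NormedSpace Metric

namespace Summit.QuantumFields.YangMills.Theorems.Prop7TwistedSliceGaugeOntoTower

open Literature.MathematicalPhysics.QuantumFieldTheory.Balaban1983to89
open T4Continuum BlockAveraging ExpMeanLog MatrixLog

/-! ## The member: T4's solvability hypothesis discharged from the tower, and (P1) -/

section Member

open scoped Matrix.Norms.L2Operator
open T3ContinuumYM3Torus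
open T3LevelShift (siteShift)
open T3PrintedRegularOrbits (sites_eq)
open T3SectALandauChart (bgUnits eta eta_pos)
open T3PrintedRegularMinimiser (RegPr)
open B10Eq27TorusAxialLog (holT gaugeActT gaugeActT_apply transl)
open B7Prop1Explicit (expUnit val_expUnit disp)
open Literature.Analysis.Calculus.ExpDifferential (ad gSer)
open Summit.QuantumFields.YangMills.Theorems.Prop8Chart (emlIterU)
open Summit.QuantumFields.YangMills.Theorems.Prop7SymAvgTwSym (tstairU vframeCovU frameAccU dbarCovIterU frameTwS frameTwS_def logChartTwS)
open Summit.QuantumFields.YangMills.Theorems.Prop7SymAvgGL (QSym)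
open B15DeterminingSets (embIter)
open Summit.QuantumFields.YangMills.Theorems.Prop7TwistedSliceTangent (hasFDerivAt_frameTwS_at_of_regPr)
open Summit.QuantumFields.YangMills.Theorems.Prop7TwistedSliceGaugeOnto (exists_slice_tangent_add_gaugeDir_of_QSym_eq_zero)
open Summit.QuantumFields.YangMills.Theorems.Prop7ChartVelocityDexp (isUnit_gSer_ad_neg)
open Summit.QuantumFields.YangMills.Theorems.Prop7FrameResponseChartGlue (fderiv_frameTwS_apply_eq_of_chartCurve exists_chartCurve_of_gaugeDir)
open Summit.QuantumFields.YangMills.Theorems.Prop7FrameLevelOnto (exists_frameCorrected_eq)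

variable (F : T3Family) {n K : ℕ} (h : n ≤ K)

/-- `η ≤ 1` (`η = L^{−(K−n)}`, `L > 1`). [folklore] -/
theorem eta_le_one : eta F n K ≤ 1 := by
  have hL : (1 : ℝ) < (F.L : ℝ) := by exact_mod_cast F.hL.2
  exact pow_le_one₀ (inv_nonneg.2 (by linarith)) (inv_le_one_of_one_le₀ hL.le)

/-- ★★★ **T4's SOLVABILITY HYPOTHESIS `hK`, DISCHARGED FROM THE TOWER.**  At a printed-regular background `U₀ ∈ 𝔘_k(ε₀)` (`10¹²L³ε₀ ≤ 1`, `10⁹L²e ≤ 1`), chart point `U′ = e^{A₁}U₀`,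
`‖A₁‖ < e·η`, with the comparison tower of `(U₀♭, U′♭)` `δ`-close at every level `j < K − n` in the GAUGE-INVARIANT sense of ✓`Prop7FrameLevelOnto.exists_frameCorrected_eq` (relative
transporters `τ_j` and loop holonomies `H_{j,y,i}^{±1}` within `δ ≤ 1/200` of `1`; frame norms `≤ 2`; displayed hypotheses `hτ hν hν' hw hH hH'`): for EVERY coarse target `m` there are a fine
gauge parameter `N` and a chart velocity `γ` with `g(ad(−A₁(b)))γ(b) = N(b₋) − U′♭(b)N(b₊)U′♭(b)⁻¹` (GLUE §2: the chart curve of the orbit) and **`N(x̂_y) − D(v(·)(y))(A₁)γ·v(A₁)(y)⁻¹ = m(y)`**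
at every comparison site (GLUE §1 turns the complex frame response into the tower's real response; the tower is solved top-down; `v` differentiable at `A₁` by ✓`hasFDerivAt_frameTwS_at_of_regPr`).
[cite: Balaban1985Averaging, (11) p.19, (58) p.27, (97) p.32; Balaban1985BackgroundPropagators, (3.19) p.393, (3.21) p.394, (3.114)-(3.115) p.418; Balaban1985Variational, (44)-(49) p.285] -/
theorem exists_gaugeParam_frameCorrected_eq {ε₀ e : ℝ} (hε₀ : 0 < ε₀) (he : 0 < e) (hWe : 10 ^ 9 * (F.L : ℝ) ^ 2 * e ≤ 1) (hWε : 10 ^ 12 * (F.L : ℝ) ^ 3 * ε₀ ≤ 1)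
    (U₀ U' : GaugeField (F.P K) 0 (Matrix.specialUnitaryGroup (Fin 2) ℂ)) (hreg : RegPr F n K ε₀ U₀)
    (A₁ : PBond (F.P K) 0 → Matrix (Fin 2) (Fin 2) ℂ) (hA₁ : ‖A₁‖ < e * eta F n K)
    (hU' : ∀ b, ((U' b : Matrix.specialUnitaryGroup (Fin 2) ℂ) : Matrix (Fin 2) (Fin 2) ℂ) = exp (A₁ b) * ((U₀ b : Matrix.specialUnitaryGroup (Fin 2) ℂ) : Matrix (Fin 2) (Fin 2) ℂ))
    {δ : ℝ} (hδ0 : 0 ≤ δ) (hδ : δ ≤ 1 / 200)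
    (hτ : ∀ (j : ℕ) (y : Site (F.P K) (j + 1)),
      j < K - n → ‖(fun i : Idx (F.P K) => ((tstairU (emlIterU j (bgUnits F K U₀)) (dbarCovIterU j (bgUnits F K U₀) (bgUnits F K U')) y i : (Matrix (Fin 2) (Fin 2) ℂ)ˣ) : Matrix (Fin 2) (Fin 2) ℂ)) - 1‖ ≤ δ)
    (hν : ∀ (j : ℕ) (x : Site (F.P K) j), j < K - n → ‖((frameAccU j (bgUnits F K U₀) (bgUnits F K U') x : (Matrix (Fin 2) (Fin 2) ℂ)ˣ) : Matrix (Fin 2) (Fin 2) ℂ)‖ ≤ 2)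
    (hν' : ∀ (j : ℕ) (x : Site (F.P K) j), j < K - n → ‖(((frameAccU j (bgUnits F K U₀) (bgUnits F K U') x)⁻¹ : (Matrix (Fin 2) (Fin 2) ℂ)ˣ) : Matrix (Fin 2) (Fin 2) ℂ)‖ ≤ 2)
    (hw : ∀ (j : ℕ) (y : Site (F.P K) (j + 1)),
      j < K - n → ‖(((vframeCovU (emlIterU j (bgUnits F K U₀)) (dbarCovIterU j (bgUnits F K U₀) (bgUnits F K U')) y)⁻¹ : (Matrix (Fin 2) (Fin 2) ℂ)ˣ) : Matrix (Fin 2) (Fin 2) ℂ)‖ ≤ 2)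
    (hH : ∀ (j : ℕ) (y : Site (F.P K) (j + 1)) (i : Idx (F.P K)), j < K - n → ‖((((frameAccU j (bgUnits F K U₀) (bgUnits F K U') (emb y) * holT (dbarCovIterU j (bgUnits F K U₀) (bgUnits F K U')) (emb y) (stairWord i.2.1 (off i.1)) * (frameAccU j (bgUnits F K U₀) (bgUnits F K U') (transl (emb y) (disp (stairWord i.2.1 (off i.1)))))⁻¹) * (frameAccU j (bgUnits F K U₀) (bgUnits F K U') (emb y) * holT (dbarCovIterU j (bgUnits F K U₀) (bgUnits F K U')) (emb y) (stairWord (1 : Equiv.Perm (Fin (F.P K).d)) (off i.1)) * (frameAccU j (bgUnits F K U₀) (bgUnits F K U') (transl (emb y) (disp (stairWord (1 : Equiv.Perm (Fin (F.P K).d)) (off i.1)))))⁻¹)⁻¹ * (frameAccU j (bgUnits F K U₀) (bgUnits F K U') (emb y) * holT (dbarCovIterU j (bgUnits F K U₀) (bgUnits F K U')) (emb y) (stairWord (1 : Equiv.Perm (Fin (F.P K).d)) (off (fun _ : Fin (F.P K).d => (⟨((F.P K).L - 1) / 2, by have := (F.P K).L_pos; omega⟩ : Fin (F.P K).L)))) *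 (frameAccU j (bgUnits F K U₀) (bgUnits F K U') (transl (emb y) (disp (stairWord (1 : Equiv.Perm (Fin (F.P K).d)) (off (fun _ : Fin (F.P K).d => (⟨((F.P K).L - 1) / 2, by have := (F.P K).L_pos; omega⟩ : Fin (F.P K).L)))))))⁻¹)) : (Matrix (Fin 2) (Fin 2) ℂ)ˣ) : Matrix (Fin 2) (Fin 2) ℂ) - 1‖ ≤ δ)
    (hH' : ∀ (j : ℕ) (y : Site (F.P K) (j + 1)) (i : Idx (F.P K)), j < K - n → ‖((((frameAccU j (bgUnits F K U₀) (bgUnits F K U') (emb y) * holT (dbarCovIterU j (bgUnits F K U₀) (bgUnits F K U')) (emb y) (stairWord i.2.1 (off i.1)) * (frameAccU j (bgUnits F K U₀) (bgUnits F K U') (transl (emb y) (disp (stairWord i.2.1 (off i.1)))))⁻¹) * (frameAccU j (bgUnits F K U₀) (bgUnits F K U') (emb y) * holT (dbarCovIterU j (bgUnits F K U₀) (bgUnits F K U')) (emb y) (stairWord (1 : Equiv.Perm (Fin (F.P K).d)) (off i.1)) * (frameAccU j (bgUnits F K U₀) (bgUnits F K U') (transl (emb y) (disp (stairWord (1 :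 Equiv.Perm (Fin (F.P K).d)) (off i.1)))))⁻¹)⁻¹ * (frameAccU j (bgUnits F K U₀) (bgUnits F K U') (emb y) * holT (dbarCovIterU j (bgUnits F K U₀) (bgUnits F K U')) (emb y) (stairWord (1 : Equiv.Perm (Fin (F.P K).d)) (off (fun _ : Fin (F.P K).d => (⟨((F.P K).L - 1) / 2, by have := (F.P K).L_pos; omega⟩ : Fin (F.P K).L)))) * (frameAccU j (bgUnits F K U₀) (bgUnits F K U') (transl (emb y) (disp (stairWord (1 : Equiv.Perm (Fin (F.P K).d)) (off (fun _ : Fin (F.P K).d => (⟨((F.P K).L - 1) / 2, by have := (F.P K).L_pos; omega⟩ : Fin (F.P K).L)))))))⁻¹))⁻¹ : (Matrix (Fin 2) (Fin 2) ℂ)ˣ) : Matrix (Fin 2) (Fin 2) ℂ) - 1‖ ≤ δ)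
    (m : Site (F.P n) 0 → Matrix (Fin 2) (Fin 2) ℂ) :
    ∃ (N : Site (F.P K) 0 → Matrix (Fin 2) (Fin 2) ℂ) (γ : PBond (F.P K) 0 → Matrix (Fin 2) (Fin 2) ℂ),
      (∀ b, gSer ℂ (ad ℂ (-A₁ b)) (γ b) = N b.src - ((bgUnits F K U' b : (Matrix (Fin 2) (Fin 2) ℂ)ˣ) : Matrix (Fin 2) (Fin 2) ℂ) * N b.tgt *
          (((bgUnits F K U' b)⁻¹ : (Matrix (Fin 2) (Fin 2) ℂ)ˣ) : Matrix (Fin 2) (Fin 2) ℂ)) ∧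
      ∀ y : Site (F.P n) 0, N (embIter (K - n) (siteShift (sites_eq F n K h) y))
          - fderiv ℂ (fun A : PBond (F.P K) 0 → Matrix (Fin 2) (Fin 2) ℂ => ((frameTwS F n K h U₀ A y : (Matrix (Fin 2) (Fin 2) ℂ)ˣ) : Matrix (Fin 2) (Fin 2) ℂ)) A₁ γ *
              (((frameTwS F n K h U₀ A₁ y)⁻¹ : (Matrix (Fin 2) (Fin 2) ℂ)ˣ) : Matrix (Fin 2) (Fin 2) ℂ) = m y := by
  -- sizes
  have hKn : K - n ≤ (F.P K).m + (F.P K).K := by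
    show K - n ≤ F.m + K
    have := F.hm
    omega
  have hL1 : (1 : ℝ) ≤ (F.L : ℝ) := by exact_mod_cast F.hL.2.le
  have he1 : e ≤ 1 / 5 := by nlinarith [hL1, he]
  have hA₁b : ∀ b, ‖A₁ b‖ ≤ e * eta F n K := fun b => (norm_le_pi_norm A₁ b).trans hA₁.le
  have hA₁5 : ∀ b, ‖A₁ b‖ ≤ 1 / 5 := fun b => (hA₁b b).trans (by nlinarith [eta_le_one F (n := n) (K := K), eta_pos F (n := n) (K := K), he.le])
  -- the configuration `e^{A₁}U₀♭ = U′♭`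
  have hcfg : (fun b : PBond (F.P K) 0 => expUnit (A₁ b) * bgUnits F K U₀ b) = bgUnits F K U' := by
    funext b; apply Units.ext; rw [Units.val_mul, val_expUnit]; exact (hU' b).symm
  -- the tower, aimed at `m` read through the site identification
  obtain ⟨N, V, hF, hρ⟩ := exists_frameCorrected_eq (bgUnits F K U₀) (bgUnits F K U') (K - n) hδ0 hδ hτ hν hν' hw hH hH' (K - n) le_rfl hKn
    (fun x => m ((siteShift (sites_eq F n K h)).symm x))
  -- the chart curve of the orbit and its velocity
  obtain ⟨c, γ, hc0, hcd, hγ, hcg⟩ := exists_chartCurve_of_gaugeDir F U₀ U' A₁ hA₁5 hU' N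
  refine ⟨N, γ, hγ, fun y => ?_⟩
  have hΦ := (hasFDerivAt_frameTwS_at_of_regPr F h hε₀ he hWe hWε U₀ hreg hA₁b y).differentiableAt
  have hV := fderiv_frameTwS_apply_eq_of_chartCurve F h U₀ U' A₁ y hΦ hc0 hcd hcg (hF (siteShift (sites_eq F n K h) y))
  have hfr : frameTwS F n K h U₀ A₁ y = frameAccU (K - n) (bgUnits F K U₀) (bgUnits F K U') (siteShift (sites_eq F n K h) y) := by
    rw [frameTwS_def, hcfg]
  rw [hV, hfr, hρ, Equiv.symm_apply_apply]

/-- ★★★ **(P1) OF `hSplitD`: `ker QSym(U′) ⊆ M·𝒯_{A₁} + 𝒢_{U′}` AT THE CHART POINT, FROM THE TOWER.**  In the setting of T2 §5 (`U₀ ∈ 𝔘_k(ε₀)`, `U′ = e^{A₁}U₀ ∈ 𝔘_k(ε₀′)`,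
`10¹²L³ε₀ ≤ 1`, `10⁹L²e ≤ 1`, `10⁷L³ε₀′ ≤ 1`, `‖A₁‖ < e·η`) with the comparison tower of `(U₀♭, U′♭)` `δ`-close below the top level (`δ ≤ 1/200`, gauge-invariant letters): every
`ξ ∈ ker QSym(U′)` splits as **`ξ = Mβ + G_{U′}N` with `D(logChartTwS U₀)(A₁)β = 0`** — a twisted-slice-TANGENT velocity plus a gauge direction at `U′`.  Proof: invert `M` bondwise
(✓`isUnit_gSer_ad_neg`), solve the frame-corrected equation with right side `−λ_{M⁻¹ξ}` by the previous theorem, and apply ✓T4 `exists_slice_tangent_add_gaugeDir_of_QSym_eq_zero`.  With ✓T3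
(the converse inclusion) this is `M(𝒯_{A₁}) + 𝒢_{U′} = ker QSym(U′) + 𝒢_{U′}` at the chart point; what remains of `hSplitD` is (P2) (Landau transversality at the chart point), the 𝔰𝔲(2)
bookkeeping, and the tower-closeness letter from `RegPr`. [cite: Balaban1985Averaging, (11) p.19, (97) p.32; Balaban1985BackgroundPropagators, (3.19) p.393, (3.21) p.394, (3.114)-(3.115) p.418; Balaban1985Variational, (44)-(49) p.285, (82)-(83) p.290] -/
theorem exists_slice_tangent_add_gaugeDir_of_QSym_eq_zero_of_tower {ε₀ ε₀' e : ℝ} (hε₀ : 0 < ε₀) (he : 0 < e) (hWe : 10 ^ 9 * (F.L : ℝ) ^ 2 * e ≤ 1)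
    (hWε : 10 ^ 12 * (F.L : ℝ) ^ 3 * ε₀ ≤ 1) (hε₀' : 0 < ε₀') (hε' : 10 ^ 7 * (F.L : ℝ) ^ 3 * ε₀' ≤ 1)
    (U₀ U' : GaugeField (F.P K) 0 (Matrix.specialUnitaryGroup (Fin 2) ℂ)) (hreg : RegPr F n K ε₀ U₀) (hreg' : RegPr F n K ε₀' U')
    (A₁ : PBond (F.P K) 0 → Matrix (Fin 2) (Fin 2) ℂ) (hA₁ : ‖A₁‖ < e * eta F n K)
    (hU' : ∀ b, ((U' b : Matrix.specialUnitaryGroup (Fin 2) ℂ) : Matrix (Fin 2) (Fin 2) ℂ) = exp (A₁ b) * ((U₀ b : Matrix.specialUnitaryGroup (Fin 2) ℂ) : Matrix (Fin 2) (Fin 2) ℂ))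
    {δ : ℝ} (hδ0 : 0 ≤ δ) (hδ : δ ≤ 1 / 200)
    (hτ : ∀ (j : ℕ) (y : Site (F.P K) (j + 1)),
      j < K - n → ‖(fun i : Idx (F.P K) => ((tstairU (emlIterU j (bgUnits F K U₀)) (dbarCovIterU j (bgUnits F K U₀) (bgUnits F K U')) y i : (Matrix (Fin 2) (Fin 2) ℂ)ˣ) : Matrix (Fin 2) (Fin 2) ℂ)) - 1‖ ≤ δ)
    (hν : ∀ (j : ℕ) (x : Site (F.P K) j), j < K - n → ‖((frameAccU j (bgUnits F K U₀) (bgUnits F K U') x : (Matrix (Fin 2) (Fin 2) ℂ)ˣ) : Matrix (Fin 2) (Fin 2) ℂ)‖ ≤ 2)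
    (hν' : ∀ (j : ℕ) (x : Site (F.P K) j), j < K - n → ‖(((frameAccU j (bgUnits F K U₀) (bgUnits F K U') x)⁻¹ : (Matrix (Fin 2) (Fin 2) ℂ)ˣ) : Matrix (Fin 2) (Fin 2) ℂ)‖ ≤ 2)
    (hw : ∀ (j : ℕ) (y : Site (F.P K) (j + 1)),
      j < K - n → ‖(((vframeCovU (emlIterU j (bgUnits F K U₀)) (dbarCovIterU j (bgUnits F K U₀) (bgUnits F K U')) y)⁻¹ : (Matrix (Fin 2) (Fin 2) ℂ)ˣ) : Matrix (Fin 2) (Fin 2) ℂ)‖ ≤ 2)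
    (hH : ∀ (j : ℕ) (y : Site (F.P K) (j + 1)) (i : Idx (F.P K)), j < K - n → ‖((((frameAccU j (bgUnits F K U₀) (bgUnits F K U') (emb y) * holT (dbarCovIterU j (bgUnits F K U₀) (bgUnits F K U')) (emb y) (stairWord i.2.1 (off i.1)) * (frameAccU j (bgUnits F K U₀) (bgUnits F K U') (transl (emb y) (disp (stairWord i.2.1 (off i.1)))))⁻¹) * (frameAccU j (bgUnits F K U₀) (bgUnits F K U') (emb y) * holT (dbarCovIterU j (bgUnits F K U₀) (bgUnits F K U')) (emb y) (stairWord (1 : Equiv.Perm (Fin (F.P K).d)) (off i.1)) * (frameAccU j (bgUnits F K U₀) (bgUnits F K U') (transl (emb y) (disp (stairWord (1 : Equiv.Perm (Fin (F.P K).d)) (off i.1)))))⁻¹)⁻¹ * (frameAccU j (bgUnits F K U₀) (bgUnits F K U') (emb y) * holT (dbarCovIterU j (bgUnits F K U₀) (bgUnits F K U')) (emb y) (stairWord (1 : Equiv.Perm (Fin (F.P K).d)) (off (fun _ : Fin (F.P K).d => (⟨((F.P K).L - 1) / 2, by have := (F.P K).L_pos; omega⟩ : Fin (F.P K).L)))) *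 (frameAccU j (bgUnits F K U₀) (bgUnits F K U') (transl (emb y) (disp (stairWord (1 : Equiv.Perm (Fin (F.P K).d)) (off (fun _ : Fin (F.P K).d => (⟨((F.P K).L - 1) / 2, by have := (F.P K).L_pos; omega⟩ : Fin (F.P K).L)))))))⁻¹)) : (Matrix (Fin 2) (Fin 2) ℂ)ˣ) : Matrix (Fin 2) (Fin 2) ℂ) - 1‖ ≤ δ)
    (hH' : ∀ (j : ℕ) (y : Site (F.P K) (j + 1)) (i : Idx (F.P K)), j < K - n → ‖((((frameAccU j (bgUnits F K U₀) (bgUnits F K U') (emb y) * holT (dbarCovIterU j (bgUnits F K U₀) (bgUnits F K U')) (emb y) (stairWord i.2.1 (off i.1)) * (frameAccU j (bgUnits F K U₀) (bgUnits F K U') (transl (emb y) (disp (stairWord i.2.1 (off i.1)))))⁻¹) * (frameAccU j (bgUnits F K U₀) (bgUnits F K U') (emb y) * holT (dbarCovIterU j (bgUnits F K U₀) (bgUnits F K U')) (emb y) (stairWord (1 : Equiv.Perm (Fin (F.P K).d)) (off i.1)) * (frameAccU j (bgUnits F K U₀) (bgUnits F K U') (transl (emb y) (disp (stairWord (1 :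 Equiv.Perm (Fin (F.P K).d)) (off i.1)))))⁻¹)⁻¹ * (frameAccU j (bgUnits F K U₀) (bgUnits F K U') (emb y) * holT (dbarCovIterU j (bgUnits F K U₀) (bgUnits F K U')) (emb y) (stairWord (1 : Equiv.Perm (Fin (F.P K).d)) (off (fun _ : Fin (F.P K).d => (⟨((F.P K).L - 1) / 2, by have := (F.P K).L_pos; omega⟩ : Fin (F.P K).L)))) * (frameAccU j (bgUnits F K U₀) (bgUnits F K U') (transl (emb y) (disp (stairWord (1 : Equiv.Perm (Fin (F.P K).d)) (off (fun _ : Fin (F.P K).d => (⟨((F.P K).L - 1) / 2, by have := (F.P K).L_pos; omega⟩ : Fin (F.P K).L)))))))⁻¹))⁻¹ : (Matrix (Fin 2) (Fin 2) ℂ)ˣ) : Matrix (Fin 2) (Fin 2) ℂ) - 1‖ ≤ δ)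
    (ξ : PBond (F.P K) 0 → Matrix (Fin 2) (Fin 2) ℂ) (hξ : QSym F n K h U' ξ = 0) :
    ∃ (β : PBond (F.P K) 0 → Matrix (Fin 2) (Fin 2) ℂ) (N : Site (F.P K) 0 → Matrix (Fin 2) (Fin 2) ℂ),
      fderiv ℂ (logChartTwS F n K h U₀) A₁ β = 0 ∧
      ∀ b, ξ b = gSer ℂ (ad ℂ (-A₁ b)) (β b) + (N b.src - ((bgUnits F K U' b : (Matrix (Fin 2) (Fin 2) ℂ)ˣ) : Matrix (Fin 2) (Fin 2) ℂ) * N b.tgt *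
          (((bgUnits F K U' b)⁻¹ : (Matrix (Fin 2) (Fin 2) ℂ)ˣ) : Matrix (Fin 2) (Fin 2) ℂ)) := by
  -- invert the velocity map bondwise to get the chart pre-velocity of `ξ`
  have hL1 : (1 : ℝ) ≤ (F.L : ℝ) := by exact_mod_cast F.hL.2.le
  have hA₁b : ∀ b, ‖A₁ b‖ ≤ e * eta F n K := fun b => (norm_le_pi_norm A₁ b).trans hA₁.le
  have hA₁2 : ∀ b, ‖A₁ b‖ ≤ 1 / 2 := fun b => (hA₁b b).trans (by nlinarith [eta_le_one F (n := n) (K := K), eta_pos F (n := n) (K := K), he.le])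
  have hM : ∀ b, IsUnit (gSer ℂ (ad ℂ (-A₁ b))) := fun b => isUnit_gSer_ad_neg (hA₁2 b)
  set β₀ : PBond (F.P K) 0 → Matrix (Fin 2) (Fin 2) ℂ := fun b => (((hM b).unit⁻¹ : (Matrix (Fin 2) (Fin 2) ℂ →L[ℂ] Matrix (Fin 2) (Fin 2) ℂ)ˣ) :
    Matrix (Fin 2) (Fin 2) ℂ →L[ℂ] Matrix (Fin 2) (Fin 2) ℂ) (ξ b) with hβ₀
  have hβ₀M : ∀ b, gSer ℂ (ad ℂ (-A₁ b)) (β₀ b) = ξ b := by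
    intro b
    have h1 : gSer ℂ (ad ℂ (-A₁ b)) = (((hM b).unit : (Matrix (Fin 2) (Fin 2) ℂ →L[ℂ] Matrix (Fin 2) (Fin 2) ℂ)ˣ) : Matrix (Fin 2) (Fin 2) ℂ →L[ℂ] Matrix (Fin 2) (Fin 2) ℂ) :=
      (hM b).unit_spec.symm
    rw [h1, hβ₀]
    show (((hM b).unit * (hM b).unit⁻¹ : (Matrix (Fin 2) (Fin 2) ℂ →L[ℂ] Matrix (Fin 2) (Fin 2) ℂ)ˣ) : Matrix (Fin 2) (Fin 2) ℂ →L[ℂ] Matrix (Fin 2) (Fin 2) ℂ) (ξ b) = ξ b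
    rw [mul_inv_cancel]
    rfl
  -- the tower solves the frame-corrected equation with right side `−λ_{β₀}`
  obtain ⟨N, γ, hγ, hN⟩ := exists_gaugeParam_frameCorrected_eq F h hε₀ he hWe hWε U₀ U' hreg A₁ hA₁ hU' hδ0 hδ hτ hν hν' hw hH hH'
    (fun y => -(fderiv ℂ (fun A : PBond (F.P K) 0 → Matrix (Fin 2) (Fin 2) ℂ => ((frameTwS F n K h U₀ A y : (Matrix (Fin 2) (Fin 2) ℂ)ˣ) : Matrix (Fin 2) (Fin 2) ℂ)) A₁ β₀ *
      (((frameTwS F n K h U₀ A₁ y)⁻¹ : (Matrix (Fin 2) (Fin 2) ℂ)ˣ) : Matrix (Fin 2) (Fin 2) ℂ)))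
  exact exists_slice_tangent_add_gaugeDir_of_QSym_eq_zero F h hε₀ he hWe hWε hε₀' hε' U₀ U' hreg hreg' A₁ hA₁ hU' ξ β₀ hξ hβ₀M ⟨N, γ, hγ, hN⟩

end Member

end Summit.QuantumFields.YangMills.Theorems.Prop7TwistedSliceGaugeOntoTower

end
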